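import Summits.BirchSwinnertonDyer.BirchSwinnertonDyer.Theorems.PrintCf2SplitBadTwoUpperHalfOfFactsKolyvaginFrameBridge
import HarnessLib

/-!
# Child crux `PrintCf2.SplitBadTwoLowerHalfOfFacts` (item 27851), line `kside_finite_two` — the Eisenstein twin of bridge B1′:
# the INDEX-currency lower bound on Heegner frames ⟺ the `Ш_an`-currency `K`-side lower half (stub D′'s text), for one `W`

Cell `bsd-print-cf2`, seat `bsd-line-cf2-p1-w4` g3 (EXTRA WIDTH seat on crux stmt-BirchSwinnertonDyer-20368; no lead live).
`--supports stmt-BirchSwinnertonDyer-27851` (helper). Theses-free; THEOREMS ONLY (0 definitions, 0 named facts, 0 `sorry`); CONDITIONAL on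
every displayed hypothesis. BSD is proved for no curve by any of this; no summit statement is proved by this seat.

WHAT. The registered research stub `stub_eisensteinLowerOverKAtTwo` of child 27851 says, in `Ш_an` currency: for `W` in the class, every
Heegner field `K` of `N_W` with `L(E^{(d_K)},1) ≠ 0` and every globally minimal `K`-model `W'` of `E_K`, `#Ш_an(W')` is a rational `q'` with
`ord₂ q' ≤ ord₂ #Ш(W')`. The main-conjecture / Eisenstein METHODS speak index currency on a Heegner frame `(N, K, Dt, H, ι, P)` with `d_K < −4`:
`2·ord₂ [E(K):ℤP] − 2·ord₂ c_Manin ≤ ord₂ #Ш(E/K)[2^∞] + ord₂ c_K` (the conclusion of `EisensteinTwo.sha_add_tamagawa_ge_of_lowerDivisibility_two`,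
p630199). This file proves the two currencies EQUIVALENT for ONE `W/ℚ` with `r_an(W) = 1`, `2 ∣ N_W` (companion of
`…UpperHalfOfFactsKolyvaginFrameBridge`, p638826, whose model-transport lemmas §1 are reused):

* §1 `lowerOverK_baseChange_of_indexLowerBound_two` / `indexLowerBound_two_of_lowerOverK_baseChange` — ONE frame, both directions, by
  Gross–Zagier's exact value `#Ш_an(E_K) = 4I²/(c²w²c_K)` with `w_K = 2`.
* §2 `lowerOverK_of_eisensteinBoundOnFrames` (+ `_of_not_good`) — D1′: toric prints + `r_an(W) = 1` + `2 ∣ N_W` + the index lower bound on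
  every frame ⟹ the text of `stub_eisensteinLowerOverKAtTwo` for `W` (the `hKlo` binder of `EisensteinTwo.missingLowerBoundAt_two_of_lowerOverK_of_twist`).
* §3 `eisensteinBoundOnFrames_of_lowerOverK` — the converse.

References: [GrossZagier1986] Thm. I.6.3, V.(2.2); [Kolyvagin1990] Thm. A; [JetchevSkinnerWan2017] §7.4.1 (shape); [SilvermanAEC2009] VII.1
Prop. 1.3(b); [Miller2011LMS] Def. 1.1.
-/

set_option autoImplicit false

-- D-0017 layout: summit = sub-problem, so `Summit.BirchSwinnertonDyer.BirchSwinnertonDyer.…` is the mandated namespace of Theorems files.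
set_option linter.dupNamespace false

noncomputable section

open scoped Classical NumberField

namespace Summit.BirchSwinnertonDyer.BirchSwinnertonDyer.Theorems.PrintCf2.KsideFiniteTwo

open WeierstrassCurve NumberField IsDedekindDomain
  Literature.NumberTheory.EllipticCurves Literature.NumberTheory.EllipticCurves.ModularForms
  Literature.NumberTheory.EllipticCurves.Rank1Residual Literature.NumberTheory.EllipticCurves.Rank1Residual.Typed
  Literature.NumberTheory.EllipticCurves.KrizLi2019
  Summit.BirchSwinnertonDyer.Rank1Residual Summit.BirchSwinnertonDyer.Rank1Residual.AdditivePotMult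
  Summit.BirchSwinnertonDyer.BirchSwinnertonDyer.Theses.UniversalToricDescent

/-! ### §1 One frame: `ord₂ #Ш_an(E_K)` computed, both directions -/

/-- **The `2`-adic valuation of the Gross–Zagier value on a Heegner frame.** `W/ℚ` elliptic, `K` imaginary quadratic with the Heegner
hypothesis for `N` and `d_K < −4`, `(Dt, H, ι, P)` a Heegner frame with `r_an(E_K) = 1`; GIVEN `hGZ`, `hKo`, `hmod`: `rank E(K) = 1`, `Ш(E_K)`
is finite, and `#Ш_an(E_K)` is the rational `q' = 4I²/(c²w²c_K)` whose `2`-adic valuation is `2·ord₂ I − 2·ord₂ c − ord₂ c_K`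
(`I = [E(K):ℤP] ≠ 0` as `P` is non-torsion, `w_K = 2`). The common core of both directions in both bridge files.
[cite: GrossZagier1986, Thm. I.6.3 and V.(2.2)] [cite: Kolyvagin1990, Thm. A] -/
theorem exists_shaAnOver_baseChange_eq_padicValRat_two
    (W : WeierstrassCurve ℚ) [W.IsElliptic] {N : ℕ} [NeZero N] (K : Type) [Field K] [NumberField K]
    (Dt : ModularParametrizationData W N) (H : HeegnerDatum N (NumberField.discr K)) (ι : K →+* ℂ)
    (P : (W.baseChange K).toAffine.Point)
    (hGZ : gross_zagier N W K) (hKo : kolyvagin N W K) (hmod : hasEntireLFunction_rat)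
    (hK : IsImaginaryQuadratic K) (hd4 : NumberField.discr K < -4) (hHN : SatisfiesHeegnerHypothesis N K)
    (hP : WeierstrassCurve.Affine.Point.map ι.toRatAlgHom P = heegnerPointComplex Dt H)
    (hrK : (W.baseChange K).analyticRank = 1) :
    Finite (W.baseChange K).sha ∧ ∃ q' : ℚ, shaAnOver (W.baseChange K) = (q' : ℂ) ∧
      padicValRat 2 q' = 2 * (padicValNat 2 (AddSubgroup.zmultiples P).index : ℤ) - 2 * (padicValNat 2 Dt.c.natAbs : ℤ) -
        (padicValNat 2 (W.baseChange K).tamagawaProduct : ℤ) := by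
  have hc0 : Dt.c ≠ 0 := Dt.maninConstant_ne_zero_holds
  obtain ⟨hrk, hShaK, hval⟩ := Summit.BirchSwinnertonDyer.Rank1Residual.P2.shaAnOver_baseChange_eq_heegnerIndex_sq W N K Dt H ι P
    hGZ hKo hmod hK hHN hP hc0 hrK
  haveI : Finite (W.baseChange K).sha := hShaK
  refine ⟨hShaK, _, hval, ?_⟩
  set I : ℕ := (AddSubgroup.zmultiples P).index with hI_def
  have hw2 : Units.torsionOrder K = 2 :=
    Literature.NumberTheory.QuadraticFields.Quadratic.torsionOrder_eq_two_of_discr_lt_neg_four hK.1 hd4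
  have hPinf : ¬ IsOfFinAddOrder P := by
    intro hfin
    have hLK := (lDerivEK_ne_zero_iff_not_isOfFinAddOrder W N K hGZ hK hHN ⟨Dt, H, ι, hP⟩).not
    obtain ⟨-, hLK'⟩ := Summit.BirchSwinnertonDyer.Rank1Residual.P2.leadingLCoeff_baseChange_eq_lDerivEK W K hmod hK.1 hrK
    exact (hLK.mpr (not_not.mpr hfin)) hLK'
  have hheight := Summit.BirchSwinnertonDyer.Rank1Residual.P2.torsionOrder_sq_mul_canonicalHeight_eq_index_sq_mul_regulator
    (W.baseChange K) hrk P hPinf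
  have htK : 0 < (W.baseChange K).torsionOrder := (W.baseChange K).torsionOrder_pos_holds
  have hI0 : I ≠ 0 := by
    intro hI
    rw [← hI_def, hI] at hheight
    have h0 : ((W.baseChange K).torsionOrder : ℝ) ^ 2 * P.canonicalHeight = 0 := by rw [hheight]; simp
    rcases mul_eq_zero.mp h0 with h' | h'
    · exact absurd ((pow_eq_zero_iff two_ne_zero).mp h') (by exact_mod_cast htK.ne')
    · exact hPinf ((Affine.Point.canonicalHeight_eq_zero_iff_holds P).mp h')
  have hcK : 0 < (W.baseChange K).tamagawaProduct := (W.baseChange K).tamagawaProduct_pos_holds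
  have hIQ : (I : ℚ) ≠ 0 := by exact_mod_cast hI0
  have hcQ : (Dt.c : ℚ) ≠ 0 := by exact_mod_cast hc0
  have hwQ : (Units.torsionOrder K : ℚ) ≠ 0 := by rw [hw2]; norm_num
  have hcKQ : ((W.baseChange K).tamagawaProduct : ℚ) ≠ 0 := by exact_mod_cast hcK.ne'
  have hcval : padicValRat 2 (Dt.c : ℚ) = (padicValNat 2 Dt.c.natAbs : ℤ) := by
    rw [padicValRat.of_int]; rfl
  have h2val : padicValRat 2 (((2 : ℕ) : ℚ)) = 1 := by
    rw [padicValRat.of_nat, padicValNat_self]; rfl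
  have h4val : padicValRat 2 (4 : ℚ) = 2 := by
    rw [show (4 : ℚ) = ((2 : ℕ) : ℚ) ^ 2 by norm_num, padicValRat.pow, h2val]; norm_num
  rw [padicValRat.div (mul_ne_zero (by norm_num) (pow_ne_zero 2 hIQ))
      (mul_ne_zero (mul_ne_zero (pow_ne_zero 2 hcQ) (pow_ne_zero 2 hwQ)) hcKQ),
    padicValRat.mul (by norm_num) (pow_ne_zero 2 hIQ), padicValRat.mul (mul_ne_zero (pow_ne_zero 2 hcQ) (pow_ne_zero 2 hwQ)) hcKQ,
    padicValRat.mul (pow_ne_zero 2 hcQ) (pow_ne_zero 2 hwQ), padicValRat.pow, padicValRat.pow, padicValRat.pow, h4val, hw2, hcval,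
    h2val, padicValRat.of_nat, padicValRat.of_nat]
  push_cast
  ring

/-- **Index lower bound ⟹ `ord₂ #Ш_an(E_K) ≤ ord₂ #Ш(E_K)` on ONE Heegner frame** (the Eisenstein twin of
`upperOverK_baseChange_of_indexBound_two`): from `2·ord₂ I − 2·ord₂ c ≤ ord₂ #Ш(E/K)[2^∞] + ord₂ c_K`.
[cite: GrossZagier1986, Thm. I.6.3 and V.(2.2)] [cite: JetchevSkinnerWan2017, §7.4.1 (shape)] -/
theorem lowerOverK_baseChange_of_indexLowerBound_two
    (W : WeierstrassCurve ℚ) [W.IsElliptic] {N : ℕ} [NeZero N] (K : Type) [Field K] [NumberField K]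
    (Dt : ModularParametrizationData W N) (H : HeegnerDatum N (NumberField.discr K)) (ι : K →+* ℂ)
    (P : (W.baseChange K).toAffine.Point)
    (hGZ : gross_zagier N W K) (hKo : kolyvagin N W K) (hmod : hasEntireLFunction_rat)
    (hK : IsImaginaryQuadratic K) (hd4 : NumberField.discr K < -4) (hHN : SatisfiesHeegnerHypothesis N K)
    (hP : WeierstrassCurve.Affine.Point.map ι.toRatAlgHom P = heegnerPointComplex Dt H)
    (hrK : (W.baseChange K).analyticRank = 1)
    (hbound : 2 * (padicValNat 2 (AddSubgroup.zmultiples P).index : ℤ) - 2 * (padicValNat 2 Dt.c.natAbs : ℤ) ≤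
      (padicValNat 2 (Nat.card (AddCommGroup.primaryComponent (W.baseChange K).sha 2)) : ℤ) +
        (padicValNat 2 (W.baseChange K).tamagawaProduct : ℤ)) :
    ∃ q' : ℚ, shaAnOver (W.baseChange K) = (q' : ℂ) ∧
      padicValRat 2 q' ≤ (padicValNat 2 (W.baseChange K).shaOrder : ℤ) := by
  obtain ⟨hShaK, q', hq', hv⟩ := exists_shaAnOver_baseChange_eq_padicValRat_two W K Dt H ι P hGZ hKo hmod hK hd4 hHN hP hrK
  haveI : Finite (W.baseChange K).sha := hShaK
  have hsha : padicValNat 2 (Nat.card (AddCommGroup.primaryComponent (W.baseChange K).sha 2)) =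
      padicValNat 2 (W.baseChange K).shaOrder :=
    Literature.NumberTheory.EllipticCurves.padicValNat_card_addPrimaryComponent 2
  refine ⟨q', hq', ?_⟩
  rw [hv, ← hsha]
  linarith

/-- **`ord₂ #Ш_an(E_K) ≤ ord₂ #Ш(E_K)` ⟹ the index lower bound, on ONE Heegner frame** (converse).
[cite: GrossZagier1986, Thm. I.6.3 and V.(2.2)] [cite: JetchevSkinnerWan2017, §7.4.1 (shape)] -/
theorem indexLowerBound_two_of_lowerOverK_baseChange
    (W : WeierstrassCurve ℚ) [W.IsElliptic] {N : ℕ} [NeZero N] (K : Type) [Field K] [NumberField K]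
    (Dt : ModularParametrizationData W N) (H : HeegnerDatum N (NumberField.discr K)) (ι : K →+* ℂ)
    (P : (W.baseChange K).toAffine.Point)
    (hGZ : gross_zagier N W K) (hKo : kolyvagin N W K) (hmod : hasEntireLFunction_rat)
    (hK : IsImaginaryQuadratic K) (hd4 : NumberField.discr K < -4) (hHN : SatisfiesHeegnerHypothesis N K)
    (hP : WeierstrassCurve.Affine.Point.map ι.toRatAlgHom P = heegnerPointComplex Dt H)
    (hrK : (W.baseChange K).analyticRank = 1)
    (hKlo : ∃ q' : ℚ, shaAnOver (W.baseChange K) = (q' : ℂ) ∧ padicValRat 2 q' ≤ (padicValNat 2 (W.baseChange K).shaOrder : ℤ)) :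
    2 * (padicValNat 2 (AddSubgroup.zmultiples P).index : ℤ) - 2 * (padicValNat 2 Dt.c.natAbs : ℤ) ≤
      (padicValNat 2 (Nat.card (AddCommGroup.primaryComponent (W.baseChange K).sha 2)) : ℤ) +
        (padicValNat 2 (W.baseChange K).tamagawaProduct : ℤ) := by
  obtain ⟨hShaK, q'', hq'', hv⟩ := exists_shaAnOver_baseChange_eq_padicValRat_two W K Dt H ι P hGZ hKo hmod hK hd4 hHN hP hrK
  haveI : Finite (W.baseChange K).sha := hShaK
  obtain ⟨q', hq', hle⟩ := hKlo
  have hqq : q' = q'' := by exact_mod_cast hq'.symm.trans hq''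
  subst hqq
  have hsha : padicValNat 2 (Nat.card (AddCommGroup.primaryComponent (W.baseChange K).sha 2)) =
      padicValNat 2 (W.baseChange K).shaOrder :=
    Literature.NumberTheory.EllipticCurves.padicValNat_card_addPrimaryComponent 2
  rw [hv] at hle
  rw [hsha]
  linarith

/-! ### §2 D1′: the index-currency lower bound on every frame ⟹ the stub text of `stub_eisensteinLowerOverKAtTwo` for `W` -/

/-- **D1′ (generic form).** ONE elliptic, globally minimal `W/ℚ` with `r_an(W) = 1` and `2 ∣ N_W`; GIVEN the toric published inputs `hF`
(Gross–Zagier, Kolyvagin, modularity, Heegner points exist) and the INDEX-currency lower bound `hEB` on every Heegner frame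
`(N, K, Dt, H, ι, P)` of `W` with `d_K < −4`, `P` non-torsion, `Ш(E/K)` finite — THEN the `Ш_an`-currency `K`-side LOWER half: at every
Heegner field `K` of `N_W` with `L(E^{(d_K)},1) ≠ 0` and every globally minimal `K`-model `W'` of `E_K`, `#Ш_an(W')` is a rational `q'` with
`ord₂ q' ≤ ord₂ #Ш(W')` (the `hKlo` binder of `EisensteinTwo.missingLowerBoundAt_two_of_lowerOverK_of_twist`). Route as in
`upperOverK_of_kolyvaginBoundOnFrames`. [cite: GrossZagier1986, Thm. I.6.3 and V.(2.2)] [cite: JetchevSkinnerWan2017, §7.4.1 (shape)]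
[cite: SilvermanAEC2009, VII.1 Prop. 1.3(b)] -/
theorem lowerOverK_of_eisensteinBoundOnFrames (hF : ToricPublishedInputs)
    (W : WeierstrassCurve ℚ) [W.IsElliptic] [W.IsGloballyMinimal] (hr : W.analyticRank = 1) (h2N : 2 ∣ W.conductorNorm ℤ)
    (hEB : ∀ (N : ℕ) [NeZero N] (K : Type) [Field K] [NumberField K] (Dt : ModularParametrizationData W N)
      (H : HeegnerDatum N (NumberField.discr K)) (ι : K →+* ℂ) (P : (W.baseChange K).toAffine.Point),
      W.conductorNorm ℤ = N → IsImaginaryQuadratic K → SatisfiesHeegnerHypothesis N K → NumberField.discr K < -4 →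
      WeierstrassCurve.Affine.Point.map ι.toRatAlgHom P = heegnerPointComplex Dt H → ¬ IsOfFinAddOrder P →
      Finite (W.baseChange K).sha →
      2 * (padicValNat 2 (AddSubgroup.zmultiples P).index : ℤ) - 2 * (padicValNat 2 Dt.c.natAbs : ℤ) ≤
        (padicValNat 2 (Nat.card (AddCommGroup.primaryComponent (W.baseChange K).sha 2)) : ℤ) +
          (padicValNat 2 (W.baseChange K).tamagawaProduct : ℤ)) :
    ∀ (N : ℕ) [NeZero N] (K : Type) [Field K] [NumberField K]
      (W' : WeierstrassCurve K) [W'.IsElliptic] [W'.IsGloballyMinimal],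
      W.conductorNorm ℤ = N → IsImaginaryQuadratic K → SatisfiesHeegnerHypothesis N K →
      (W.quadraticTwist (NumberField.discr K : ℚ)).entireLFunction 1 ≠ 0 →
      (∃ C : VariableChange K, C • W.baseChange K = W') →
      ∃ q' : ℚ, shaAnOver W' = (q' : ℂ) ∧ padicValRat 2 q' ≤ (padicValNat 2 W'.shaOrder : ℤ) := by
  intro N _ K _ _ W' _ _ hN hK hHN hLt hW'
  obtain ⟨hGZ, hKo, -, hmod, -, -, -, -, -, hHP⟩ := hF
  subst hN
  have h2 : Module.finrank ℚ K = 2 := hK.1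
  have h8 : NumberField.discr K % 8 = 1 := Literature.SatisfiesHeegnerHypothesis.discr_emod_eight h2 hHN h2N
  have hd4 : NumberField.discr K < -4 := by
    have hneg : NumberField.discr K < 0 := hK.discr_neg
    omega
  obtain ⟨P, Dt, H, ι, hP⟩ := hHP W K hK hHN
  have hL0 : W.entireLFunction 1 = 0 := entireLFunction_one_eq_zero_of_analyticRank_eq_one hr
  obtain ⟨-, hderiv⟩ := leadingLCoeff_eq_deriv_of_analyticRank_eq_one hr
  have hLK : LDerivEK W K ≠ 0 := by
    rw [lDerivEK_eq_deriv_mul W K hmod hL0]; exact mul_ne_zero hderiv hLt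
  have hnt : ¬ IsOfFinAddOrder P :=
    (lDerivEK_ne_zero_iff_not_isOfFinAddOrder W (W.conductorNorm ℤ) K (hGZ _ W K) hK hHN ⟨Dt, H, ι, hP⟩).mp hLK
  have hKoK : Literature.NumberTheory.EllipticCurves.kolyvagin (W.conductorNorm ℤ) W K := hKo _ W K
  obtain ⟨-, hfinK⟩ := hKoK hK hHN ⟨Dt, H, ι, hP⟩ hnt
  haveI hfin : Finite (W.baseChange K).sha := hfinK
  have hD0 : (NumberField.discr K : ℚ) ≠ 0 := by exact_mod_cast NumberField.discr_ne_zero K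
  haveI hEt : (W.quadraticTwist (NumberField.discr K : ℚ)).IsElliptic := W.isElliptic_quadraticTwist hD0
  have hrd0 : (W.quadraticTwist (NumberField.discr K : ℚ)).analyticRank = 0 :=
    ((W.quadraticTwist (NumberField.discr K : ℚ)).analyticRank_eq_zero_iff_holds (hmod _)).mpr hLt
  have hrK : (W.baseChange K).analyticRank = 1 :=
    (Summit.BirchSwinnertonDyer.Rank1Residual.P2.analyticRank_baseChange_eq_one_iff W K hmod h2).mpr (Or.inl ⟨hr, hrd0⟩)
  have hb := hEB (W.conductorNorm ℤ) K Dt H ι P rfl hK hHN hd4 hP hnt hfin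
  obtain ⟨q', hq', hle⟩ := lowerOverK_baseChange_of_indexLowerBound_two W K Dt H ι P (hGZ _ W K) hKoK hmod hK hd4 hHN hP hrK hb
  haveI : (W.baseChange K).IsGloballyMinimal := W.isGloballyMinimal_baseChange_of_satisfiesHeegnerHypothesis K h2 hHN
  haveI : (W.baseChange K).IsElliptic := isElliptic_baseChange' W K
  obtain ⟨C, hC⟩ := hW'
  refine ⟨q', ?_, ?_⟩
  · rw [shaAnOver_eq_of_isGloballyMinimal (W.baseChange K) W' C hC, hq']
  · rw [shaOrder_eq_of_smul_eq (W.baseChange K) W' C hC]; exact hle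

/-- **D1′ (class form).** For `W` with `r_an(W) = 1` and bad reduction at `2`, the index lower bound on frames gives the text of
`stub_eisensteinLowerOverKAtTwo` for `W` (CM and `CMSplit` unused). [cite: GrossZagier1986, V.(2.2)] [cite: JetchevSkinnerWan2017, §7.4.1 (shape)] -/
theorem lowerOverK_of_eisensteinBoundOnFrames_of_not_good (hF : ToricPublishedInputs)
    (W : WeierstrassCurve ℚ) [W.IsElliptic] [W.IsGloballyMinimal] (hr : W.analyticRank = 1) (hng : ¬ Good W 2)
    (hEB : ∀ (N : ℕ) [NeZero N] (K : Type) [Field K] [NumberField K] (Dt : ModularParametrizationData W N)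
      (H : HeegnerDatum N (NumberField.discr K)) (ι : K →+* ℂ) (P : (W.baseChange K).toAffine.Point),
      W.conductorNorm ℤ = N → IsImaginaryQuadratic K → SatisfiesHeegnerHypothesis N K → NumberField.discr K < -4 →
      WeierstrassCurve.Affine.Point.map ι.toRatAlgHom P = heegnerPointComplex Dt H → ¬ IsOfFinAddOrder P →
      Finite (W.baseChange K).sha →
      2 * (padicValNat 2 (AddSubgroup.zmultiples P).index : ℤ) - 2 * (padicValNat 2 Dt.c.natAbs : ℤ) ≤
        (padicValNat 2 (Nat.card (AddCommGroup.primaryComponent (W.baseChange K).sha 2)) : ℤ) +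
          (padicValNat 2 (W.baseChange K).tamagawaProduct : ℤ)) :
    ∀ (N : ℕ) [NeZero N] (K : Type) [Field K] [NumberField K]
      (W' : WeierstrassCurve K) [W'.IsElliptic] [W'.IsGloballyMinimal],
      W.conductorNorm ℤ = N → IsImaginaryQuadratic K → SatisfiesHeegnerHypothesis N K →
      (W.quadraticTwist (NumberField.discr K : ℚ)).entireLFunction 1 ≠ 0 →
      (∃ C : VariableChange K, C • W.baseChange K = W') →
      ∃ q' : ℚ, shaAnOver W' = (q' : ℂ) ∧ padicValRat 2 q' ≤ (padicValNat 2 W'.shaOrder : ℤ) :=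
  lowerOverK_of_eisensteinBoundOnFrames hF W hr ((W.dvd_conductorNorm_iff_not_hasGoodReductionAtPrime 2).mpr hng) hEB

/-! ### §3 The converse: the `Ш_an`-currency lower half ⟹ the index lower bound on every frame -/

/-- **The converse of D1′ (currency EQUIVALENCE).** For ONE `W/ℚ` with `r_an(W) = 1`, GIVEN the toric prints: the `Ш_an`-currency `K`-side
LOWER half `hKlo` (the text of `stub_eisensteinLowerOverKAtTwo` for `W`) implies the INDEX-currency lower bound on every Heegner frame of `W`
with `d_K < −4` and `P` non-torsion (`P` non-torsion ⟹ `L(E^{(d_K)},1) ≠ 0`, `r_an(E_K) = 1`; `hKlo` at `W' = E_K`; Gross–Zagier backwards).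
[cite: GrossZagier1986, Thm. I.6.3 and V.(2.2)] [cite: JetchevSkinnerWan2017, §7.4.1 (shape)] -/
theorem eisensteinBoundOnFrames_of_lowerOverK (hF : ToricPublishedInputs)
    (W : WeierstrassCurve ℚ) [W.IsElliptic] [W.IsGloballyMinimal] (hr : W.analyticRank = 1)
    (hKlo : ∀ (N : ℕ) [NeZero N] (K : Type) [Field K] [NumberField K]
      (W' : WeierstrassCurve K) [W'.IsElliptic] [W'.IsGloballyMinimal],
      W.conductorNorm ℤ = N → IsImaginaryQuadratic K → SatisfiesHeegnerHypothesis N K →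
      (W.quadraticTwist (NumberField.discr K : ℚ)).entireLFunction 1 ≠ 0 →
      (∃ C : VariableChange K, C • W.baseChange K = W') →
      ∃ q' : ℚ, shaAnOver W' = (q' : ℂ) ∧ padicValRat 2 q' ≤ (padicValNat 2 W'.shaOrder : ℤ)) :
    ∀ (N : ℕ) [NeZero N] (K : Type) [Field K] [NumberField K] (Dt : ModularParametrizationData W N)
      (H : HeegnerDatum N (NumberField.discr K)) (ι : K →+* ℂ) (P : (W.baseChange K).toAffine.Point),
      W.conductorNorm ℤ = N → IsImaginaryQuadratic K → SatisfiesHeegnerHypothesis N K → NumberField.discr K < -4 →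
      WeierstrassCurve.Affine.Point.map ι.toRatAlgHom P = heegnerPointComplex Dt H → ¬ IsOfFinAddOrder P →
      Finite (W.baseChange K).sha →
      2 * (padicValNat 2 (AddSubgroup.zmultiples P).index : ℤ) - 2 * (padicValNat 2 Dt.c.natAbs : ℤ) ≤
        (padicValNat 2 (Nat.card (AddCommGroup.primaryComponent (W.baseChange K).sha 2)) : ℤ) +
          (padicValNat 2 (W.baseChange K).tamagawaProduct : ℤ) := by
  intro N _ K _ _ Dt H ι P hN hK hHN hd4 hP hnt _
  obtain ⟨hGZ, hKo, -, hmod, -, -, -, -, -, -⟩ := hF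
  subst hN
  have h2 : Module.finrank ℚ K = 2 := hK.1
  have hL0 : W.entireLFunction 1 = 0 := entireLFunction_one_eq_zero_of_analyticRank_eq_one hr
  have hLK : LDerivEK W K ≠ 0 :=
    (lDerivEK_ne_zero_iff_not_isOfFinAddOrder W (W.conductorNorm ℤ) K (hGZ _ W K) hK hHN ⟨Dt, H, ι, hP⟩).mpr hnt
  have hLt : (W.quadraticTwist (NumberField.discr K : ℚ)).entireLFunction 1 ≠ 0 := by
    intro h0
    apply hLK
    rw [lDerivEK_eq_deriv_mul W K hmod hL0, h0, mul_zero]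
  have hD0 : (NumberField.discr K : ℚ) ≠ 0 := by exact_mod_cast NumberField.discr_ne_zero K
  haveI hEt : (W.quadraticTwist (NumberField.discr K : ℚ)).IsElliptic := W.isElliptic_quadraticTwist hD0
  have hrd0 : (W.quadraticTwist (NumberField.discr K : ℚ)).analyticRank = 0 :=
    ((W.quadraticTwist (NumberField.discr K : ℚ)).analyticRank_eq_zero_iff_holds (hmod _)).mpr hLt
  have hrK : (W.baseChange K).analyticRank = 1 :=
    (Summit.BirchSwinnertonDyer.Rank1Residual.P2.analyticRank_baseChange_eq_one_iff W K hmod h2).mpr (Or.inl ⟨hr, hrd0⟩)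
  haveI : (W.baseChange K).IsGloballyMinimal := W.isGloballyMinimal_baseChange_of_satisfiesHeegnerHypothesis K h2 hHN
  haveI : (W.baseChange K).IsElliptic := isElliptic_baseChange' W K
  have hKlo₁ := hKlo (W.conductorNorm ℤ) K (W.baseChange K) rfl hK hHN hLt ⟨1, one_smul _ _⟩
  exact indexLowerBound_two_of_lowerOverK_baseChange W K Dt H ι P (hGZ _ W K) (hKo _ W K) hmod hK hd4 hHN hP hrK hKlo₁

end Summit.BirchSwinnertonDyer.BirchSwinnertonDyer.Theorems.PrintCf2.KsideFiniteTwo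

end
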